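import Summits.ABC.ABC.Theorems.IneffectiveSubspaceAbcGivesUniformSadic
import Summits.ABC.ABC.Theorems.IneffectiveSubspaceUniformSadicTowerFourFlatSteepSplitCore

/-!
# `UniformSadicTowerFour` (stmt-ABC-14937): both sharpened children are implied by `ABC` (line `flat-steep-split`)

Honesty certificates for a route-level split of the crux into FLAT-QUARTER and HEAVY-CORE
(`FlatSteepSplitCore.uniformSadicTowerFour_iff_quarter_and_core`): each child is a consequence of the
summit statement `ABC` — through the landed `abcGivesUniformSadic_proof : ABC → UniformSadicTowerFour`
(item AbcGivesUniformSadic) and the converse half of the iff — so neither child is stronger than the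
summit, and a refutation of either refutes `ABC` (`not_abc_of_not_flatQuarter`, `not_abc_of_not_heavyCore`).
-/

-- `Summit.<Summit>.<Problem>` is the mandated summit-side namespace (CONVENTIONS §2); for the
-- single-conjunct summit `ABC` the two coincide, so the duplicate `ABC.ABC` is deliberate.
set_option linter.dupNamespace false

namespace Summit.ABC.ABC.Theorems.UniformSadicTowerFour.FlatSteepSplit

open Literature.NumberTheory.DiophantineGeometry (IsABCTriple)
open Summit.ABC.ABC.Theses.IneffectiveSubspace
open scoped BigOperators

/-- **FLAT-QUARTER is implied by `ABC`** (registered stub `flatQuarter_of_abc`). [folklore] -/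
theorem flatQuarter_of_abc (habc : ABC) :
    ∀ ε : ℝ, 0 < ε → ∃ C : ℝ, 0 < C ∧ ∀ a b c : ℕ, IsABCTriple a b c →
      (∀ p ∈ (a * b * c).primeFactors,
        ((p ^ (a * b * c).factorization p : ℕ) : ℝ) < (c : ℝ) ^ (1 / 4 : ℝ)) →
      (c : ℝ) < C * ((∏ p ∈ (a * b * c).primeFactors,
        p ^ (((a * b * c).factorization p + 3) / 4) : ℕ) : ℝ) ^ (1 + ε) :=
  (uniformSadicTowerFour_iff_quarter_and_core.mp (abcGivesUniformSadic_proof habc)).1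

/-- **HEAVY-CORE is implied by `ABC`.** [folklore] -/
theorem heavyCore_of_abc (habc : ABC) :
    ∀ θ : ℝ, 0 < θ → θ ≤ 1 → ∀ ε : ℝ, 0 < ε → ∃ C : ℝ, 0 < C ∧ ∀ S : Finset ℕ, S.Nonempty →
      (∀ p ∈ S, Nat.Prime p) → ∀ a b c : ℕ, IsABCTriple a b c →
      (∀ p ∈ S, (c : ℝ) ^ θ ≤ ((p ^ (a * b * c).factorization p : ℕ) : ℝ)) →
      (c : ℝ) < C * ((((∏ p ∈ S, p) *
        ∏ p ∈ (a * b * c).primeFactors \ S, p ^ (((a * b * c).factorization p + 3) / 4) : ℕ) : ℝ)) ^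
          (1 + ε) :=
  (uniformSadicTowerFour_iff_quarter_and_core.mp (abcGivesUniformSadic_proof habc)).2

/-- A refutation of FLAT-QUARTER refutes `ABC`. [folklore] -/
theorem not_abc_of_not_flatQuarter
    (h : ¬ ∀ ε : ℝ, 0 < ε → ∃ C : ℝ, 0 < C ∧ ∀ a b c : ℕ, IsABCTriple a b c →
      (∀ p ∈ (a * b * c).primeFactors,
        ((p ^ (a * b * c).factorization p : ℕ) : ℝ) < (c : ℝ) ^ (1 / 4 : ℝ)) →
      (c : ℝ) < C * ((∏ p ∈ (a * b * c).primeFactors,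
        p ^ (((a * b * c).factorization p + 3) / 4) : ℕ) : ℝ) ^ (1 + ε)) :
    ¬ ABC :=
  fun habc => h (flatQuarter_of_abc habc)

/-- A refutation of HEAVY-CORE refutes `ABC`. [folklore] -/
theorem not_abc_of_not_heavyCore
    (h : ¬ ∀ θ : ℝ, 0 < θ → θ ≤ 1 → ∀ ε : ℝ, 0 < ε → ∃ C : ℝ, 0 < C ∧ ∀ S : Finset ℕ, S.Nonempty →
      (∀ p ∈ S, Nat.Prime p) → ∀ a b c : ℕ, IsABCTriple a b c →
      (∀ p ∈ S, (c : ℝ) ^ θ ≤ ((p ^ (a * b * c).factorization p : ℕ) : ℝ)) →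
      (c : ℝ) < C * ((((∏ p ∈ S, p) *
        ∏ p ∈ (a * b * c).primeFactors \ S, p ^ (((a * b * c).factorization p + 3) / 4) : ℕ) : ℝ)) ^
          (1 + ε)) :
    ¬ ABC :=
  fun habc => h (heavyCore_of_abc habc)

end Summit.ABC.ABC.Theorems.UniformSadicTowerFour.FlatSteepSplit
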